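import Literature.Analysis.FluidPDE.CarlemanCalculusOpen
import Literature.Analysis.FluidPDE.HeatPotentialRepresentation
import HarnessLib

/-!
# Cut-off calculus and the Caccioppoli (energy) inequality for the backward heat inequality

Analysis/FluidPDE support file (everything proved) on the discharge path of the named fact
`Literature.Analysis.FluidPDE.Carleman.seregin_backwardHeat_localMax_le_L2`
(`BackwardHeatRegularity.lean`; Seregin 2014, App. A.2, Remark A.2 — the local maximum estimate
`sup (|u| + |∇u|) ≤ c ‖u‖_{L²}` for functions with `|∂ₜu + Δu| ≤ c₁(|u| + |∇u|)`, quoted by Seregin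
from Ladyženskaja–Solonnikov–Ural'ceva 1968). Uncurried space–time fields `ℝ × E → F` (time
first), frame operators `dt`, `dx`, `lap`, `gradSq` of `CarlemanCalculus.lean`. Contents:

* **cut-off products** `W = Φ • u` of a compactly supported `Φ ∈ C²(ℝ × E)` with
  `tsupport Φ ⊆ U`, `U` open, and `u ∈ C²(U; F)`: `W ∈ C²_c(ℝ × E; F)` and the Leibniz formulas
  for `∂ₜW`, `∂ₑW`, `∂ₑ∂ₑ'W`, `ΔₓW`, valid at **every** point (off `tsupport Φ` both sides vanish)
  (`dt_cutoff_smul`, `dx_cutoff_smul`, `dx_dx_cutoff_smul`, `lap_cutoff_smul`);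
* **components** `u_c = ⟪u, c⟫`: `∂(u_c) = ⟪∂u, c⟫` for `∂ ∈ {∂ₜ, ∂ₑ, ∂ₑ∂ₑ', Δₓ}` on `U`
  (`dt_inner_const`, …, `lap_inner_const`);
* **the weighted energy inequality** (`integral_mul_gradSq_le`): for `W ∈ C²_c(ℝ × E; F)` and a
  `C¹` time weight `g` with `g' ≥ 0`,
  `∫ g(t) |∇ₓW|² ≤ -∫ g(t) ⟪W, ∂ₜW + ΔₓW⟫`
  (Green's formula in space, and `2∫ g ⟪W, ∂ₜW⟫ = -∫ g' ‖W‖² ≤ 0`: for the backward operator the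
  boundary term at the bottom of a cylinder has the good sign);
* **Caccioppoli's inequality for the backward heat inequality**
  (`integral_mul_sq_mul_gradSq_le`): if `‖∂ₜu + Δₓu‖ ≤ c₁ (‖u‖ + |∇ₓu|)` on `U` and `Ξ` is a `C²`
  cut-off with `|Ξ| ≤ 1`, `tsupport Ξ ⊆ U`, then for every `C¹` weight `g ≥ 0` with `g' ≥ 0`
  `∫ g Ξ² |∇ₓu|² ≤ 4 ∫ g ((c₁ + 2c₁²) Ξ² + 9 |∇ₓΞ|² + |∂ₜΞ + ΔₓΞ|) ‖u‖²`
  (test the inequality with `Ξ²u`, i.e. apply the energy inequality to `W = Ξ • u` and absorb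
  the gradient terms by Young's inequality).

These are the standard first steps of the local regularity theory (Ladyženskaja–Solonnikov–
Ural'ceva 1968, Ch. III §2, the energy inequality; Lieberman 1996, Ch. VI, Lemma 6.2), written
for classical (`C²`) solutions of a differential *inequality*, for which they are elementary.

## References

* O. A. Ladyženskaja, V. A. Solonnikov, N. N. Ural'ceva, *Linear and quasi-linear equations of
  parabolic type*, AMS 1968, Ch. III §2.
* G. M. Lieberman, *Second order parabolic differential equations*, World Scientific 1996,
  Ch. VI §1.
* G. Seregin, *Lecture notes on regularity theory for the Navier–Stokes equations*, World
  Scientific 2014, App. A.2, Remark A.2.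
-/

noncomputable section

open MeasureTheory Set Function Filter TopologicalSpace
open scoped Topology RealInnerProductSpace

namespace Literature.Analysis.FluidPDE

namespace Carleman

variable {E : Type*} [NormedAddCommGroup E] [InnerProductSpace ℝ E] [FiniteDimensional ℝ E]
  [MeasurableSpace E] [BorelSpace E]
variable {F : Type*} [NormedAddCommGroup F] [InnerProductSpace ℝ F]

/-! ### Cut-off products `Φ • u` -/

section Cutoff

variable {U : Set (ℝ × E)} {Φ : ℝ × E → ℝ} {u : ℝ × E → F}

omit [FiniteDimensional ℝ E] [MeasurableSpace E] [BorelSpace E] [InnerProductSpace ℝ E] in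
/-- **Gluing.** If `Φ ∈ Cⁿ` has `tsupport Φ ⊆ U`, `U` open, and `u ∈ Cⁿ(U)`, then `Φ • u ∈ Cⁿ`
on the whole space (it vanishes near every point off `U`). [folklore] -/
theorem contDiff_cutoff_smul [NormedSpace ℝ E] {n : WithTop ℕ∞} (hU : IsOpen U)
    (hΦ : ContDiff ℝ n Φ) (hΦU : tsupport Φ ⊆ U) (hu : ContDiffOn ℝ n u U) :
    ContDiff ℝ n fun z => Φ z • u z := by
  refine contDiff_iff_contDiffAt.2 fun z => ?_
  by_cases hz : z ∈ U
  · exact hΦ.contDiffAt.smul (hu.contDiffAt (hU.mem_nhds hz))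
  · have hz' : z ∉ tsupport Φ := fun h => hz (hΦU h)
    have hev : (fun y => Φ y • u y) =ᶠ[𝓝 z] fun _ => 0 := by
      filter_upwards [notMem_tsupport_iff_eventuallyEq.1 hz'] with w hw
      rw [hw, Pi.zero_apply, zero_smul]
    exact contDiffAt_const.congr_of_eventuallyEq hev

omit [FiniteDimensional ℝ E] [MeasurableSpace E] [BorelSpace E] [InnerProductSpace ℝ E]
  [InnerProductSpace ℝ F] in
/-- `tsupport (Φ • u) ⊆ tsupport Φ`. [folklore] -/
theorem tsupport_cutoff_smul_subset [NormedSpace ℝ F] :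
    tsupport (fun z => Φ z • u z) ⊆ tsupport Φ :=
  tsupport_smul_subset_left Φ u

omit [FiniteDimensional ℝ E] [MeasurableSpace E] [BorelSpace E] [InnerProductSpace ℝ E]
  [InnerProductSpace ℝ F] in
/-- `Φ • u` is compactly supported when `Φ` is. [folklore] -/
theorem hasCompactSupport_cutoff_smul [NormedSpace ℝ F] (hΦc : HasCompactSupport Φ) :
    HasCompactSupport fun z => Φ z • u z :=
  hΦc.smul_right

omit [FiniteDimensional ℝ E] [MeasurableSpace E] [BorelSpace E] [InnerProductSpace ℝ E] in
/-- **Leibniz rule for a cut-off product, at every point**: if `Φ ∈ C¹`, `tsupport Φ ⊆ U`,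
`U` open, `u` differentiable on `U`, then
`D(Φ • u)(z) w = Φ(z) • Du(z) w + (DΦ(z) w) • u(z)` for all `z` (off `tsupport Φ` both sides
vanish). [folklore] -/
theorem fderiv_cutoff_smul_apply [NormedSpace ℝ E] (hU : IsOpen U) (hΦ : ContDiff ℝ 1 Φ)
    (hΦU : tsupport Φ ⊆ U) (hu : DifferentiableOn ℝ u U) (z w : ℝ × E) :
    fderiv ℝ (fun y => Φ y • u y) z w = Φ z • fderiv ℝ u z w + fderiv ℝ Φ z w • u z := by
  by_cases hz : z ∈ U
  · have hΦd : DifferentiableAt ℝ Φ z := hΦ.differentiable one_ne_zero z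
    have hud : DifferentiableAt ℝ u z := hu.differentiableAt (hU.mem_nhds hz)
    rw [fderiv_fun_smul hΦd hud]
    simp
  · have hz' : z ∉ tsupport Φ := fun h => hz (hΦU h)
    have h0 : fderiv ℝ (fun y => Φ y • u y) z = 0 :=
      fderiv_of_notMem_tsupport (𝕜 := ℝ) fun h => hz' (tsupport_cutoff_smul_subset h)
    rw [h0, image_eq_zero_of_notMem_tsupport hz', fderiv_of_notMem_tsupport (𝕜 := ℝ) hz']
    simp

omit [FiniteDimensional ℝ E] [MeasurableSpace E] [BorelSpace E] in
/-- `∂ₜ(Φ • u) = Φ • ∂ₜu + ∂ₜΦ • u` everywhere. [folklore] -/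
theorem dt_cutoff_smul (hU : IsOpen U) (hΦ : ContDiff ℝ 1 Φ) (hΦU : tsupport Φ ⊆ U)
    (hu : DifferentiableOn ℝ u U) (z : ℝ × E) :
    dt (fun y => Φ y • u y) z = Φ z • dt u z + dt Φ z • u z :=
  fderiv_cutoff_smul_apply hU hΦ hΦU hu z _

omit [FiniteDimensional ℝ E] [MeasurableSpace E] [BorelSpace E] in
/-- `∂ₑ(Φ • u) = Φ • ∂ₑu + ∂ₑΦ • u` everywhere. [folklore] -/
theorem dx_cutoff_smul (hU : IsOpen U) (hΦ : ContDiff ℝ 1 Φ) (hΦU : tsupport Φ ⊆ U)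
    (hu : DifferentiableOn ℝ u U) (e : E) (z : ℝ × E) :
    dx e (fun y => Φ y • u y) z = Φ z • dx e u z + dx e Φ z • u z :=
  fderiv_cutoff_smul_apply hU hΦ hΦU hu z _

omit [FiniteDimensional ℝ E] [MeasurableSpace E] [BorelSpace E] [InnerProductSpace ℝ F] in
/-- On an open set where `u ∈ C²`, the frame derivative `∂ₑu` is differentiable. [folklore] -/
theorem differentiableAt_dx_of_contDiffOn [NormedSpace ℝ F] (hU : IsOpen U)
    (hu : ContDiffOn ℝ 2 u U) (e : E) {z : ℝ × E} (hz : z ∈ U) : DifferentiableAt ℝ (dx e u) z := by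
  have h1 : ContDiffOn ℝ 1 (fun y => fderiv ℝ u y (0, e)) U :=
    (hu.fderiv_of_isOpen hU le_rfl).clm_apply contDiffOn_const
  exact (h1.differentiableOn one_ne_zero).differentiableAt (hU.mem_nhds hz)

omit [FiniteDimensional ℝ E] [MeasurableSpace E] [BorelSpace E] [InnerProductSpace ℝ F] in
/-- On an open set where `u ∈ C²`, the time derivative `∂ₜu` is differentiable. [folklore] -/
theorem differentiableAt_dt_of_contDiffOn [NormedSpace ℝ F] (hU : IsOpen U)
    (hu : ContDiffOn ℝ 2 u U) {z : ℝ × E} (hz : z ∈ U) : DifferentiableAt ℝ (dt u) z := by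
  have h1 : ContDiffOn ℝ 1 (fun y => fderiv ℝ u y (1, 0)) U :=
    (hu.fderiv_of_isOpen hU le_rfl).clm_apply contDiffOn_const
  exact (h1.differentiableOn one_ne_zero).differentiableAt (hU.mem_nhds hz)

omit [FiniteDimensional ℝ E] [MeasurableSpace E] [BorelSpace E] in
/-- **Second-order Leibniz rule for a cut-off product, at every point**:
`∂ₑ∂ₑ'(Φ • u) = Φ • ∂ₑ∂ₑ'u + ∂ₑΦ • ∂ₑ'u + ∂ₑ'Φ • ∂ₑu + ∂ₑ∂ₑ'Φ • u` for `Φ ∈ C²` with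
`tsupport Φ ⊆ U` and `u ∈ C²(U)`. [folklore] -/
theorem dx_dx_cutoff_smul (hU : IsOpen U) (hΦ : ContDiff ℝ 2 Φ) (hΦU : tsupport Φ ⊆ U)
    (hu : ContDiffOn ℝ 2 u U) (e e' : E) (z : ℝ × E) :
    dx e (dx e' (fun y => Φ y • u y)) z =
      Φ z • dx e (dx e' u) z + dx e Φ z • dx e' u z + dx e' Φ z • dx e u z +
        dx e (dx e' Φ) z • u z := by
  have hΦ1 : ContDiff ℝ 1 Φ := hΦ.of_le (by norm_num)
  have hud : DifferentiableOn ℝ u U := hu.differentiableOn (by norm_num)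
  have hfun : dx e' (fun y => Φ y • u y) = fun y => Φ y • dx e' u y + dx e' Φ y • u y :=
    funext fun y => dx_cutoff_smul hU hΦ1 hΦU hud e' y
  rw [dx_apply, hfun]
  have hdΦ1 : ContDiff ℝ 1 (dx e' Φ) := contDiff_one_dx_of_contDiff_two hΦ e'
  by_cases hz : z ∈ U
  · have hΦd : DifferentiableAt ℝ Φ z := hΦ1.differentiable one_ne_zero z
    have hdΦd : DifferentiableAt ℝ (dx e' Φ) z := hdΦ1.differentiable one_ne_zero z
    have hudz : DifferentiableAt ℝ u z := hud.differentiableAt (hU.mem_nhds hz)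
    have hdud : DifferentiableAt ℝ (dx e' u) z := differentiableAt_dx_of_contDiffOn hU hu e' hz
    have hder : HasFDerivAt (fun y => Φ y • dx e' u y + dx e' Φ y • u y)
        ((Φ z • fderiv ℝ (dx e' u) z + (fderiv ℝ Φ z).smulRight (dx e' u z)) +
          (dx e' Φ z • fderiv ℝ u z + (fderiv ℝ (dx e' Φ) z).smulRight (u z))) z :=
      (hΦd.hasFDerivAt.smul hdud.hasFDerivAt).add (hdΦd.hasFDerivAt.smul hudz.hasFDerivAt)
    rw [hder.fderiv]
    simp only [FunLike.coe_add, Pi.add_apply, FunLike.coe_smul,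
      Pi.smul_apply, ContinuousLinearMap.smulRight_apply, dx_apply]
    abel
  · have hz' : z ∉ tsupport Φ := fun h => hz (hΦU h)
    have hz'' : z ∉ tsupport (dx e' Φ) := fun h => hz' (tsupport_dx_subset e' Φ h)
    -- the function vanishes near `z`
    have hev : (fun y => Φ y • dx e' u y + dx e' Φ y • u y) =ᶠ[𝓝 z] fun _ => 0 := by
      filter_upwards [notMem_tsupport_iff_eventuallyEq.1 hz',
        notMem_tsupport_iff_eventuallyEq.1 hz''] with y hy hy'
      rw [hy, hy', Pi.zero_apply, zero_smul, zero_smul, add_zero]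
    have h0 : fderiv ℝ (fun y => Φ y • dx e' u y + dx e' Φ y • u y) z = 0 := by
      rw [hev.fderiv_eq]; exact fderiv_const_apply _
    rw [h0, image_eq_zero_of_notMem_tsupport hz', image_eq_zero_of_notMem_tsupport hz'',
      show dx e Φ z = 0 from by rw [dx_apply, fderiv_of_notMem_tsupport (𝕜 := ℝ) hz']; rfl,
      show dx e (dx e' Φ) z = 0 from by rw [dx_apply, fderiv_of_notMem_tsupport (𝕜 := ℝ) hz'']; rfl]
    simp

omit [MeasurableSpace E] [BorelSpace E] in
/-- **Laplacian of a cut-off product, at every point**: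
`Δₓ(Φ • u) = Φ • Δₓu + 2 Σᵢ ∂ᵢΦ • ∂ᵢu + ΔₓΦ • u`. [folklore] -/
theorem lap_cutoff_smul (hU : IsOpen U) (hΦ : ContDiff ℝ 2 Φ) (hΦU : tsupport Φ ⊆ U)
    (hu : ContDiffOn ℝ 2 u U) (z : ℝ × E) :
    lap (fun y => Φ y • u y) z =
      Φ z • lap u z + (2 : ℝ) • ∑ i, dx (stdOrthonormalBasis ℝ E i) Φ z •
        dx (stdOrthonormalBasis ℝ E i) u z + lap Φ z • u z := by
  simp only [lap, dx_dx_cutoff_smul hU hΦ hΦU hu, Finset.sum_add_distrib, Finset.smul_sum,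
    Finset.sum_smul, two_smul]
  abel

omit [MeasurableSpace E] [BorelSpace E] in
/-- `|∇ₓ(Φ • u)|² = Σᵢ ‖Φ ∂ᵢu + ∂ᵢΦ u‖²` everywhere. [folklore] -/
theorem gradSq_cutoff_smul (hU : IsOpen U) (hΦ : ContDiff ℝ 1 Φ) (hΦU : tsupport Φ ⊆ U)
    (hu : DifferentiableOn ℝ u U) (z : ℝ × E) :
    gradSq (fun y => Φ y • u y) z =
      ∑ i, ‖Φ z • dx (stdOrthonormalBasis ℝ E i) u z + dx (stdOrthonormalBasis ℝ E i) Φ z • u z‖ ^ 2 := by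
  simp only [gradSq, dx_cutoff_smul hU hΦ hΦU hu]

end Cutoff

/-! ### Components `⟪u, c⟫` -/

section Components

variable {U : Set (ℝ × E)} {u : ℝ × E → F} {c : F}

omit [FiniteDimensional ℝ E] [MeasurableSpace E] [BorelSpace E] in
/-- `D⟪u, c⟫(z) w = ⟪Du(z) w, c⟫` at a point of differentiability. [folklore] -/
theorem fderiv_apply_inner_const {z : ℝ × E} (hu : DifferentiableAt ℝ u z) (w : ℝ × E) :
    fderiv ℝ (fun y => ⟪u y, c⟫) z w = ⟪fderiv ℝ u z w, c⟫ := by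
  rw [fderiv_inner_apply (𝕜 := ℝ) hu (differentiableAt_const c)]
  simp

omit [FiniteDimensional ℝ E] [MeasurableSpace E] [BorelSpace E] in
/-- `∂ₜ⟪u, c⟫ = ⟪∂ₜu, c⟫` at a point of differentiability. [folklore] -/
theorem dt_inner_const {z : ℝ × E} (hu : DifferentiableAt ℝ u z) :
    dt (fun y => ⟪u y, c⟫) z = ⟪dt u z, c⟫ :=
  fderiv_apply_inner_const hu _

omit [FiniteDimensional ℝ E] [MeasurableSpace E] [BorelSpace E] in
/-- `∂ₑ⟪u, c⟫ = ⟪∂ₑu, c⟫` at a point of differentiability. [folklore] -/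
theorem dx_inner_const {z : ℝ × E} (hu : DifferentiableAt ℝ u z) (e : E) :
    dx e (fun y => ⟪u y, c⟫) z = ⟪dx e u z, c⟫ :=
  fderiv_apply_inner_const hu _

omit [FiniteDimensional ℝ E] [MeasurableSpace E] [BorelSpace E] in
/-- `∂ₑ∂ₑ'⟪u, c⟫ = ⟪∂ₑ∂ₑ'u, c⟫` on an open set where `u ∈ C²`. [folklore] -/
theorem dx_dx_inner_const (hU : IsOpen U) (hu : ContDiffOn ℝ 2 u U) (e e' : E) {z : ℝ × E}
    (hz : z ∈ U) : dx e (dx e' fun y => ⟪u y, c⟫) z = ⟪dx e (dx e' u) z, c⟫ := by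
  have hud : ∀ y ∈ U, DifferentiableAt ℝ u y := fun y hy =>
    (hu.differentiableOn (by norm_num)).differentiableAt (hU.mem_nhds hy)
  have hev : dx e' (fun y => ⟪u y, c⟫) =ᶠ[𝓝 z] fun y => ⟪dx e' u y, c⟫ := by
    filter_upwards [hU.mem_nhds hz] with y hy
    exact dx_inner_const (hud y hy) e'
  rw [dx_apply, hev.fderiv_eq]
  exact fderiv_apply_inner_const (differentiableAt_dx_of_contDiffOn hU hu e' hz) _

omit [MeasurableSpace E] [BorelSpace E] in
/-- `Δₓ⟪u, c⟫ = ⟪Δₓu, c⟫` on an open set where `u ∈ C²`. [folklore] -/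
theorem lap_inner_const (hU : IsOpen U) (hu : ContDiffOn ℝ 2 u U) {z : ℝ × E} (hz : z ∈ U) :
    lap (fun y => ⟪u y, c⟫) z = ⟪lap u z, c⟫ := by
  simp only [lap, dx_dx_inner_const hU hu _ _ hz, sum_inner]

omit [FiniteDimensional ℝ E] [MeasurableSpace E] [BorelSpace E] in
/-- Components are `C²` where the field is. [folklore] -/
theorem contDiffOn_inner_const {n : WithTop ℕ∞} (hu : ContDiffOn ℝ n u U) :
    ContDiffOn ℝ n (fun y => ⟪u y, c⟫) U :=
  hu.inner ℝ contDiffOn_const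

omit [MeasurableSpace E] [BorelSpace E] in
/-- `Σᵢ ⟪∂ᵢu, c⟫² ≤ ‖c‖² |∇ₓu|²`: the gradient of a component is at most `‖c‖` times the
gradient. [folklore] -/
theorem gradSq_inner_const_le (hU : IsOpen U) (hu : ContDiffOn ℝ 2 u U) {z : ℝ × E} (hz : z ∈ U) :
    gradSq (fun y => ⟪u y, c⟫) z ≤ ‖c‖ ^ 2 * gradSq u z := by
  have hud : DifferentiableAt ℝ u z :=
    (hu.differentiableOn (by norm_num)).differentiableAt (hU.mem_nhds hz)
  simp only [gradSq, dx_inner_const hud, Finset.mul_sum]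
  refine Finset.sum_le_sum fun i _ => ?_
  rw [Real.norm_eq_abs, sq_abs]
  have h := abs_real_inner_le_norm (dx (stdOrthonormalBasis ℝ E i) u z) c
  have h2 : ⟪dx (stdOrthonormalBasis ℝ E i) u z, c⟫ ^ 2 ≤ (‖dx (stdOrthonormalBasis ℝ E i) u z‖ * ‖c‖) ^ 2 :=
    sq_le_sq' (abs_le.1 h).1 (abs_le.1 h).2
  nlinarith [h2]

end Components

/-! ### The weighted energy inequality for `C²_c` fields -/

section Energy

variable {g : ℝ → ℝ} {W : ℝ × E → F}

/-- **Green's formula in space with a time weight**, `C²` version: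
`∫ g(t) ⟪W, ΔₓW⟫ = -∫ g(t) |∇ₓW|²` for `W ∈ C²_c(ℝ × E; F)` and `g ∈ C¹(ℝ)`. [folklore] -/
theorem integral_mul_inner_lap_eq_neg_integral_mul_gradSq (hg : ContDiff ℝ 1 g)
    (hW : ContDiff ℝ 2 W) (hWc : HasCompactSupport W) :
    ∫ z, g z.1 * ⟪W z, lap W z⟫ = -∫ z, g z.1 * gradSq W z := by
  set b := stdOrthonormalBasis ℝ E with hb
  have hw : ContDiffOn ℝ 1 (fun z : ℝ × E => g z.1) univ := (contDiff_comp_fst hg).contDiffOn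
  have hW1 : ContDiff ℝ 1 W := hW.of_le (by norm_num)
  have hdW1 : ∀ i, ContDiff ℝ 1 (dx (b i) W) := fun i => contDiff_one_dx_of_contDiff_two hW _
  have cg : Continuous fun z : ℝ × E => g z.1 := (contDiff_comp_fst (E := E) hg).continuous
  have step : ∀ i, ∫ z, g z.1 * ⟪W z, dx (b i) (dx (b i) W) z⟫ =
      -∫ z, g z.1 * ‖dx (b i) W z‖ ^ 2 := by
    intro i
    have h := integral_mul_inner_fderiv_eq_of_open isOpen_univ hw hW1 (hdW1 i) hWc
      (hasCompactSupport_dx hWc _) (subset_univ _) (0, b i)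
    simp only [fderiv_comp_fst_apply hg, mul_zero, zero_mul, integral_zero, neg_zero,
      zero_sub] at h
    have h' : ∫ z, g z.1 * ⟪W z, dx (b i) (dx (b i) W) z⟫ =
        -∫ z, g z.1 * ⟪dx (b i) W z, dx (b i) W z⟫ := by simpa only [dx_apply] using h
    rw [h']
    congr 1
    refine integral_congr_ae (Eventually.of_forall fun z => ?_)
    show g z.1 * ⟪dx (b i) W z, dx (b i) W z⟫ = g z.1 * ‖dx (b i) W z‖ ^ 2
    rw [real_inner_self_eq_norm_sq]
  have i1 : ∀ i, Integrable fun z => g z.1 * ⟪W z, dx (b i) (dx (b i) W) z⟫ := fun i =>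
    integrable_of_continuous_hasCompactSupport
      (cg.mul (hW.continuous.inner (continuous_dx_dx_of_contDiff_two hW _ _)))
      (hasCompactSupport_mul_inner_left hWc)
  have i2 : ∀ i, Integrable fun z => g z.1 * ‖dx (b i) W z‖ ^ 2 := fun i =>
    integrable_of_continuous_hasCompactSupport
      (cg.mul ((continuous_dx_of_contDiff_two hW _).norm.pow 2))
      (hasCompactSupport_mul_norm_sq (hasCompactSupport_dx hWc _))
  calc ∫ z, g z.1 * ⟪W z, lap W z⟫
      = ∫ z, ∑ i, g z.1 * ⟪W z, dx (b i) (dx (b i) W) z⟫ := by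
        refine integral_congr_ae (Eventually.of_forall fun z => ?_)
        show g z.1 * ⟪W z, lap W z⟫ = ∑ i, g z.1 * ⟪W z, dx (b i) (dx (b i) W) z⟫
        rw [lap, ← Finset.mul_sum, ← inner_sum]
    _ = ∑ i, ∫ z, g z.1 * ⟪W z, dx (b i) (dx (b i) W) z⟫ := integral_finsetSum _ fun i _ => i1 i
    _ = ∑ i, -∫ z, g z.1 * ‖dx (b i) W z‖ ^ 2 := Finset.sum_congr rfl fun i _ => step i
    _ = -∫ z, ∑ i, g z.1 * ‖dx (b i) W z‖ ^ 2 := by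
        rw [Finset.sum_neg_distrib, integral_finsetSum _ fun i _ => i2 i]
    _ = -∫ z, g z.1 * gradSq W z := by
        congr 1
        refine integral_congr_ae (Eventually.of_forall fun z => ?_)
        show ∑ i, g z.1 * ‖dx (b i) W z‖ ^ 2 = g z.1 * gradSq W z
        rw [gradSq, Finset.mul_sum]

/-- **The weighted energy inequality.** For `W ∈ C²_c(ℝ × E; F)` and a `C¹` time weight `g`
with `g' ≥ 0`:
`∫ g(t) |∇ₓW|² ≤ -∫ g(t) ⟪W, ∂ₜW + ΔₓW⟫`
(`∫ g ⟪W, ΔₓW⟫ = -∫ g |∇ₓW|²` and `2∫ g ⟪W, ∂ₜW⟫ = -∫ g' ‖W‖² ≤ 0`). This is the energy identity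
for the backward heat operator, the boundary term being absorbed by the monotone weight
(Ladyženskaja–Solonnikov–Ural'ceva 1968, Ch. III §2). [folklore] -/
theorem integral_mul_gradSq_le (hg : ContDiff ℝ 1 g) (hg' : ∀ s, 0 ≤ deriv g s)
    (hW : ContDiff ℝ 2 W) (hWc : HasCompactSupport W) :
    ∫ z, g z.1 * gradSq W z ≤ -∫ z, g z.1 * ⟪W z, dt W z + lap W z⟫ := by
  have hlap := integral_mul_inner_lap_eq_neg_integral_mul_gradSq hg hW hWc
  have hw : ContDiffOn ℝ 1 (fun z : ℝ × E => g z.1) univ := (contDiff_comp_fst hg).contDiffOn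
  have hW1 : ContDiff ℝ 1 W := hW.of_le (by norm_num)
  have cg : Continuous fun z : ℝ × E => g z.1 := (contDiff_comp_fst (E := E) hg).continuous
  have ht := two_mul_integral_mul_inner_fderiv_self_of_open isOpen_univ hw hW1 hWc
    (subset_univ _) (1, 0)
  simp only [fderiv_comp_fst_apply hg, mul_one] at ht
  have hnn : 0 ≤ ∫ z, deriv g z.1 * ‖W z‖ ^ 2 :=
    integral_nonneg fun z => mul_nonneg (hg' _) (sq_nonneg _)
  have hdt : ∫ z, g z.1 * ⟪W z, dt W z⟫ ≤ 0 := by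
    have : ∫ z, g z.1 * ⟪W z, dt W z⟫ = ∫ z, g z.1 * ⟪W z, fderiv ℝ W z (1, 0)⟫ := rfl
    linarith
  have i1 : Integrable fun z => g z.1 * ⟪W z, dt W z⟫ :=
    integrable_of_continuous_hasCompactSupport
      (cg.mul (hW.continuous.inner (continuous_dt_of_contDiff_two hW)))
      (hasCompactSupport_mul_inner_left hWc)
  have i2 : Integrable fun z => g z.1 * ⟪W z, lap W z⟫ :=
    integrable_of_continuous_hasCompactSupport
      (cg.mul (hW.continuous.inner (continuous_lap_of_contDiff_two hW)))
      (hasCompactSupport_mul_inner_left hWc)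
  have hsplit : ∫ z, g z.1 * ⟪W z, dt W z + lap W z⟫ =
      (∫ z, g z.1 * ⟪W z, dt W z⟫) + ∫ z, g z.1 * ⟪W z, lap W z⟫ := by
    rw [← integral_add i1 i2]
    refine integral_congr_ae (Eventually.of_forall fun z => ?_)
    show g z.1 * ⟪W z, dt W z + lap W z⟫ = g z.1 * ⟪W z, dt W z⟫ + g z.1 * ⟪W z, lap W z⟫
    rw [inner_add_right, mul_add]
  rw [hsplit, hlap]
  linarith

end Energy

/-! ### Caccioppoli's inequality for the backward heat inequality -/

section Caccioppoli

variable {U : Set (ℝ × E)} {u : ℝ × E → F} {Ξ : ℝ × E → ℝ} {g : ℝ → ℝ} {c₁ : ℝ}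

omit [MeasurableSpace E] [BorelSpace E] in
/-- `tsupport |∇ₓV|² ⊆ tsupport V`. [folklore] -/
theorem tsupport_gradSq_subset {G : Type*} [NormedAddCommGroup G] [NormedSpace ℝ G]
    (V : ℝ × E → G) : tsupport (gradSq V) ⊆ tsupport V := by
  refine closure_minimal (fun z hz => ?_) (isClosed_tsupport _)
  by_contra h
  refine hz ?_
  simp only [gradSq]
  refine Finset.sum_eq_zero fun i _ => ?_
  rw [dx_apply, fderiv_of_notMem_tsupport (𝕜 := ℝ) h]
  simp

/-- Integrands that are continuous on `U` and vanish off the support of a compactly supported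
cut-off with `tsupport Ξ ⊆ U` are integrable. [folklore] -/
theorem integrable_of_continuousOn_of_eq_zero_off_tsupport (hU : IsOpen U) {f : ℝ × E → ℝ}
    (hf : ContinuousOn f U) (hΞc : HasCompactSupport Ξ) (hΞU : tsupport Ξ ⊆ U)
    (h0 : ∀ z ∉ tsupport Ξ, f z = 0) : Integrable f (volume : Measure (ℝ × E)) :=
  integrable_of_continuous_hasCompactSupport
    (continuous_of_continuousOn_of_eq_zero hU (isClosed_tsupport Ξ) hΞU hf h0)
    (hΞc.mono' fun z hz => by
      by_contra h
      exact hz (h0 z h))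

omit [MeasurableSpace E] [BorelSpace E] [InnerProductSpace ℝ F] [FiniteDimensional ℝ E] in
/-- Continuity on `U` of `u`, `∂ₜu`, `∂ₑu`, `∂ₑ∂ₑ'u` for `u ∈ C²(U)`. [folklore] -/
theorem continuousOn_derivatives [NormedSpace ℝ F] (hU : IsOpen U) (hu : ContDiffOn ℝ 2 u U) :
    ContinuousOn u U ∧ ContinuousOn (dt u) U ∧ (∀ e, ContinuousOn (dx e u) U) ∧
      ∀ e e', ContinuousOn (dx e (dx e' u)) U := by
  have h1 : ContinuousOn (fderiv ℝ u) U := hu.continuousOn_fderiv_of_isOpen hU (by norm_num)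
  have h2 : ∀ e', ContDiffOn ℝ 1 (fun y => fderiv ℝ u y (0, e')) U := fun e' =>
    (hu.fderiv_of_isOpen hU le_rfl).clm_apply contDiffOn_const
  refine ⟨hu.continuousOn, h1.clm_apply continuousOn_const, fun e => h1.clm_apply continuousOn_const,
    fun e e' => ?_⟩
  exact ((h2 e').continuousOn_fderiv_of_isOpen hU le_rfl).clm_apply continuousOn_const

omit [MeasurableSpace E] [BorelSpace E] [InnerProductSpace ℝ F] in
/-- Continuity on `U` of `Δₓu` and `|∇ₓu|²` for `u ∈ C²(U)`. [folklore] -/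
theorem continuousOn_lap_gradSq [NormedSpace ℝ F] (hU : IsOpen U) (hu : ContDiffOn ℝ 2 u U) :
    ContinuousOn (lap u) U ∧ ContinuousOn (gradSq u) U := by
  obtain ⟨-, -, hdx, hdd⟩ := continuousOn_derivatives hU hu
  refine ⟨?_, ?_⟩
  · change ContinuousOn (fun z => ∑ i, dx (stdOrthonormalBasis ℝ E i)
      (dx (stdOrthonormalBasis ℝ E i) u) z) U
    exact continuousOn_finsetSum _ fun i _ => hdd _ _
  · change ContinuousOn (fun z => ∑ i, ‖dx (stdOrthonormalBasis ℝ E i) u z‖ ^ 2) U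
    exact continuousOn_finsetSum _ fun i _ => ((hdx _).norm).pow 2

omit [MeasurableSpace E] [BorelSpace E] [InnerProductSpace ℝ F] in
/-- The elementary inequality `‖a‖²/2 - ‖b‖² ≤ ‖a + b‖²`. [folklore] -/
theorem half_sq_norm_sub_sq_norm_le (a b : F) : ‖a‖ ^ 2 / 2 - ‖b‖ ^ 2 ≤ ‖a + b‖ ^ 2 := by
  have h : ‖a‖ ≤ ‖a + b‖ + ‖b‖ := by
    calc ‖a‖ = ‖(a + b) - b‖ := by rw [add_sub_cancel_right]
      _ ≤ ‖a + b‖ + ‖b‖ := norm_sub_le _ _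
  nlinarith [norm_nonneg a, norm_nonneg b, norm_nonneg (a + b), sq_nonneg (‖a + b‖ - ‖b‖)]

/-- **Caccioppoli's inequality for the backward heat inequality.** Let `U ⊆ ℝ × E` be open,
`u ∈ C²(U; F)` with `‖∂ₜu + Δₓu‖ ≤ c₁ (‖u‖ + |∇ₓu|)` on `U` (`c₁ ≥ 0`), `Ξ ∈ C²(ℝ × E)` a
compactly supported cut-off with `|Ξ| ≤ 1` and `tsupport Ξ ⊆ U`, and `g ∈ C¹(ℝ)` a time weight
with `g ≥ 0`, `g' ≥ 0`. Then
`∫ g Ξ² |∇ₓu|² ≤ 4 ∫ g ((c₁ + 2c₁²) Ξ² + 9 |∇ₓΞ|² + |∂ₜΞ + ΔₓΞ|) ‖u‖²`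
(the energy inequality `integral_mul_gradSq_le` for `W = Ξ • u`, the Leibniz formulas, and
Young's inequality; Ladyženskaja–Solonnikov–Ural'ceva 1968, Ch. III §2; Lieberman 1996,
Lemma 6.2). [folklore] -/
theorem integral_mul_sq_mul_gradSq_le (hU : IsOpen U) (hu : ContDiffOn ℝ 2 u U) (hc₁ : 0 ≤ c₁)
    (hineq : ∀ z ∈ U, ‖dt u z + lap u z‖ ≤ c₁ * (‖u z‖ + Real.sqrt (gradSq u z)))
    (hΞ : ContDiff ℝ 2 Ξ) (hΞc : HasCompactSupport Ξ) (hΞU : tsupport Ξ ⊆ U)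
    (hΞ1 : ∀ z, |Ξ z| ≤ 1) (hg : ContDiff ℝ 1 g) (hg0 : ∀ s, 0 ≤ g s)
    (hg' : ∀ s, 0 ≤ deriv g s) :
    ∫ z, g z.1 * (Ξ z ^ 2 * gradSq u z) ≤
      4 * ∫ z, g z.1 * (((c₁ + 2 * c₁ ^ 2) * Ξ z ^ 2 + 9 * gradSq Ξ z + |dt Ξ z + lap Ξ z|) *
        ‖u z‖ ^ 2) := by
  set b := stdOrthonormalBasis ℝ E with hb
  set W : ℝ × E → F := fun z => Ξ z • u z with hWdef
  have hΞ1' : ContDiff ℝ 1 Ξ := hΞ.of_le (by norm_num)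
  have hud : DifferentiableOn ℝ u U := hu.differentiableOn (by norm_num)
  have hW : ContDiff ℝ 2 W := contDiff_cutoff_smul hU hΞ hΞU hu
  have hWc : HasCompactSupport W := hasCompactSupport_cutoff_smul hΞc
  have hB1 := integral_mul_gradSq_le hg hg' hW hWc
  -- continuity data
  obtain ⟨cu, cdtu, cdxu, -⟩ := continuousOn_derivatives hU hu
  obtain ⟨clapu, cgsu⟩ := continuousOn_lap_gradSq hU hu
  have cg : Continuous fun z : ℝ × E => g z.1 := (contDiff_comp_fst (E := E) hg).continuous
  have cΞ : Continuous Ξ := hΞ.continuous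
  have cdtΞ : Continuous (dt Ξ) := continuous_dt_of_contDiff_two hΞ
  have clapΞ : Continuous (lap Ξ) := continuous_lap_of_contDiff_two hΞ
  have cgsΞ : Continuous (gradSq Ξ) := by
    change Continuous fun z => ∑ i, ‖dx (stdOrthonormalBasis ℝ E i) Ξ z‖ ^ 2
    exact continuous_finsetSum _ fun i _ => ((continuous_dx_of_contDiff_two hΞ _).norm).pow 2
  -- vanishing off the support of `Ξ`
  have hΞ0 : ∀ z ∉ tsupport Ξ, Ξ z = 0 := fun z hz => image_eq_zero_of_notMem_tsupport hz
  have hgsΞ0 : ∀ z ∉ tsupport Ξ, gradSq Ξ z = 0 := fun z hz =>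
    image_eq_zero_of_notMem_tsupport fun h => hz (tsupport_gradSq_subset Ξ h)
  have hdtΞ0 : ∀ z ∉ tsupport Ξ, dt Ξ z = 0 := fun z hz =>
    image_eq_zero_of_notMem_tsupport fun h => hz (tsupport_dt_subset Ξ h)
  have hlapΞ0 : ∀ z ∉ tsupport Ξ, lap Ξ z = 0 := fun z hz =>
    image_eq_zero_of_notMem_tsupport fun h => hz (tsupport_lap_subset Ξ h)
  -- abbreviations for the two sides
  set A : ℝ × E → ℝ := fun z =>
    (c₁ + 2 * c₁ ^ 2) * Ξ z ^ 2 + 8 * gradSq Ξ z + |dt Ξ z + lap Ξ z| with hA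
  have hA0 : ∀ z, 0 ≤ A z := fun z =>
    add_nonneg (add_nonneg (mul_nonneg (by positivity) (sq_nonneg _))
      (mul_nonneg (by norm_num) (gradSq_nonneg _ _))) (abs_nonneg _)
  -- (P1) lower bound for `g |∇W|²`
  have P1 : ∀ z, g z.1 * ((1 / 2) * (Ξ z ^ 2 * gradSq u z) - gradSq Ξ z * ‖u z‖ ^ 2) ≤
      g z.1 * gradSq W z := by
    intro z
    refine mul_le_mul_of_nonneg_left ?_ (hg0 _)
    rw [gradSq_cutoff_smul hU hΞ1' hΞU hud z]
    have hterm : ∀ i, (1 / 2) * (Ξ z ^ 2 * ‖dx (b i) u z‖ ^ 2) - ‖dx (b i) Ξ z‖ ^ 2 * ‖u z‖ ^ 2 ≤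
        ‖Ξ z • dx (b i) u z + dx (b i) Ξ z • u z‖ ^ 2 := by
      intro i
      have h := half_sq_norm_sub_sq_norm_le (Ξ z • dx (b i) u z) (dx (b i) Ξ z • u z)
      rw [norm_smul, norm_smul, mul_pow, mul_pow, Real.norm_eq_abs, sq_abs] at h
      linarith
    calc (1 / 2) * (Ξ z ^ 2 * gradSq u z) - gradSq Ξ z * ‖u z‖ ^ 2
        = ∑ i, ((1 / 2) * (Ξ z ^ 2 * ‖dx (b i) u z‖ ^ 2) - ‖dx (b i) Ξ z‖ ^ 2 * ‖u z‖ ^ 2) := by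
          simp only [gradSq, Finset.mul_sum, Finset.sum_mul, Finset.sum_sub_distrib, hb]
      _ ≤ ∑ i, ‖Ξ z • dx (b i) u z + dx (b i) Ξ z • u z‖ ^ 2 := Finset.sum_le_sum fun i _ => hterm i
  -- (P2) upper bound for `-g ⟪W, ∂ₜW + ΔW⟫`
  have P2 : ∀ z, -(g z.1 * ⟪W z, dt W z + lap W z⟫) ≤
      g z.1 * ((1 / 4) * (Ξ z ^ 2 * gradSq u z) + A z * ‖u z‖ ^ 2) := by
    intro z
    by_cases hz : z ∈ U
    · -- the source of `W`
      set X : F := dt u z + lap u z with hX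
      set S : F := ∑ i, dx (b i) Ξ z • dx (b i) u z with hS
      set D : ℝ := dt Ξ z + lap Ξ z with hD
      have hsrc : dt W z + lap W z = Ξ z • X + D • u z + (2 : ℝ) • S := by
        rw [hWdef, dt_cutoff_smul hU hΞ1' hΞU hud z, lap_cutoff_smul hU hΞ hΞU hu z]
        simp only [hX, hS, hD, smul_add, add_smul]
        abel
      have hWz : W z = Ξ z • u z := rfl
      have hinner : ⟪W z, dt W z + lap W z⟫ =
          Ξ z * (Ξ z * ⟪u z, X⟫) + Ξ z * (D * ‖u z‖ ^ 2) + Ξ z * (2 * ⟪u z, S⟫) := by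
        rw [hsrc, hWz]
        simp only [inner_add_right, real_inner_smul_left, real_inner_smul_right,
          real_inner_self_eq_norm_sq]
        ring
      -- the scalar quantities
      set a : ℝ := ‖u z‖ with ha
      set ξ : ℝ := |Ξ z| with hξ
      set r : ℝ := Real.sqrt (gradSq u z) with hr
      set s : ℝ := Real.sqrt (gradSq Ξ z) with hs
      have ha0 : 0 ≤ a := norm_nonneg _
      have hξ0 : 0 ≤ ξ := abs_nonneg _
      have hξ1z : ξ ≤ 1 := hΞ1 z
      have hr0 : 0 ≤ r := Real.sqrt_nonneg _
      have hs0 : 0 ≤ s := Real.sqrt_nonneg _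
      have hr2 : r ^ 2 = gradSq u z := Real.sq_sqrt (gradSq_nonneg u z)
      have hs2 : s ^ 2 = gradSq Ξ z := Real.sq_sqrt (gradSq_nonneg Ξ z)
      have hξ2 : ξ ^ 2 = Ξ z ^ 2 := sq_abs _
      -- `|⟪u, X⟫| ≤ a c₁ (a + r)`
      have hX' : |⟪u z, X⟫| ≤ a * (c₁ * (a + r)) :=
        (abs_real_inner_le_norm _ _).trans (mul_le_mul_of_nonneg_left (hineq z hz) ha0)
      -- `|⟪u, S⟫| ≤ a s r`
      have hSn : ‖S‖ ≤ s * r := by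
        calc ‖S‖ ≤ ∑ i, ‖dx (b i) Ξ z • dx (b i) u z‖ := norm_sum_le _ _
          _ = ∑ i, |dx (b i) Ξ z| * ‖dx (b i) u z‖ := by
              refine Finset.sum_congr rfl fun i _ => ?_
              rw [norm_smul, Real.norm_eq_abs]
          _ ≤ Real.sqrt (∑ i, |dx (b i) Ξ z| ^ 2) * Real.sqrt (∑ i, ‖dx (b i) u z‖ ^ 2) :=
              Real.sum_mul_le_sqrt_mul_sqrt _ _ _
          _ = s * r := by simp only [hs, hr, gradSq, Real.norm_eq_abs, hb]
      have hS' : |⟪u z, S⟫| ≤ a * (s * r) :=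
        (abs_real_inner_le_norm _ _).trans (mul_le_mul_of_nonneg_left hSn ha0)
      -- bound of the pairing
      have hbound : |⟪W z, dt W z + lap W z⟫| ≤
          ξ ^ 2 * (a * (c₁ * (a + r))) + ξ * (|D| * a ^ 2) + ξ * (2 * (a * (s * r))) := by
        rw [hinner]
        refine (abs_add_le _ _).trans (add_le_add ((abs_add_le _ _).trans (add_le_add ?_ ?_)) ?_)
        · rw [abs_mul, abs_mul, ← hξ, ← mul_assoc, ← sq]
          exact mul_le_mul_of_nonneg_left hX' (sq_nonneg _)
        · rw [abs_mul, abs_mul, ← hξ, abs_of_nonneg (sq_nonneg a)]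
        · rw [abs_mul, abs_mul, ← hξ, abs_two]
          exact mul_le_mul_of_nonneg_left (mul_le_mul_of_nonneg_left hS' zero_le_two) hξ0
      -- Young
      have hyoung : ξ ^ 2 * (a * (c₁ * (a + r))) + ξ * (|D| * a ^ 2) + ξ * (2 * (a * (s * r))) ≤
          (1 / 4) * (ξ ^ 2 * r ^ 2) + ((c₁ + 2 * c₁ ^ 2) * ξ ^ 2 + 8 * s ^ 2 + |D|) * a ^ 2 := by
        have hD0 : 0 ≤ |D| := abs_nonneg _
        nlinarith [mul_nonneg (sq_nonneg ξ) (sq_nonneg (4 * c₁ * a - r)),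
          sq_nonneg (8 * s * a - ξ * r), mul_nonneg (mul_nonneg (sub_nonneg.2 hξ1z) hD0) (sq_nonneg a),
          mul_nonneg hξ0 ha0, mul_nonneg (sq_nonneg ξ) (mul_nonneg ha0 hr0)]
      have hfin : -(g z.1 * ⟪W z, dt W z + lap W z⟫) ≤
          g z.1 * ((1 / 4) * (ξ ^ 2 * r ^ 2) + ((c₁ + 2 * c₁ ^ 2) * ξ ^ 2 + 8 * s ^ 2 + |D|) * a ^ 2) := by
        have h1 : -(g z.1 * ⟪W z, dt W z + lap W z⟫) ≤ g z.1 * |⟪W z, dt W z + lap W z⟫| := by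
          rw [← mul_neg]
          exact mul_le_mul_of_nonneg_left (neg_le_abs _) (hg0 _)
        exact h1.trans (mul_le_mul_of_nonneg_left (hbound.trans hyoung) (hg0 _))
      simpa only [hA, hξ2, hr2, hs2, hD, ha] using hfin
    · have hz' : z ∉ tsupport Ξ := fun h => hz (hΞU h)
      have hWz : W z = 0 := by
        show Ξ z • u z = 0
        rw [hΞ0 z hz', zero_smul]
      rw [hWz, inner_zero_left, mul_zero, neg_zero]
      exact mul_nonneg (hg0 _) (add_nonneg (mul_nonneg (by norm_num)
        (mul_nonneg (sq_nonneg _) (gradSq_nonneg _ _))) (mul_nonneg (hA0 z) (sq_nonneg _)))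
  -- integrability of the four integrands
  have Iq : Integrable (fun z => g z.1 * (Ξ z ^ 2 * gradSq u z)) (volume : Measure (ℝ × E)) :=
    integrable_of_continuousOn_of_eq_zero_off_tsupport hU
      ((cg.continuousOn.mul ((cΞ.pow 2).continuousOn.mul cgsu))) hΞc hΞU
      (fun z hz => by simp [hΞ0 z hz])
  have IG : Integrable (fun z => g z.1 * (gradSq Ξ z * ‖u z‖ ^ 2)) (volume : Measure (ℝ × E)) :=
    integrable_of_continuousOn_of_eq_zero_off_tsupport hU
      (cg.continuousOn.mul (cgsΞ.continuousOn.mul (cu.norm.pow 2))) hΞc hΞU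
      (fun z hz => by simp [hgsΞ0 z hz])
  have IA : Integrable (fun z => g z.1 * (A z * ‖u z‖ ^ 2)) (volume : Measure (ℝ × E)) :=
    integrable_of_continuousOn_of_eq_zero_off_tsupport hU
      (cg.continuousOn.mul ((((continuous_const.mul (cΞ.pow 2)).add
        (continuous_const.mul cgsΞ)).add (cdtΞ.add clapΞ).abs).continuousOn.mul (cu.norm.pow 2)))
      hΞc hΞU (fun z hz => by
        have hAz : A z = 0 := by
          simp only [hA, hΞ0 z hz, hgsΞ0 z hz, hdtΞ0 z hz, hlapΞ0 z hz]
          norm_num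
        rw [hAz, zero_mul, mul_zero])
  have IW : Integrable (fun z => g z.1 * gradSq W z) (volume : Measure (ℝ × E)) := by
    refine integrable_of_continuous_hasCompactSupport (cg.mul ?_) ?_
    · change Continuous fun z => ∑ i, ‖dx (stdOrthonormalBasis ℝ E i) W z‖ ^ 2
      exact continuous_finsetSum _ fun i _ => ((continuous_dx_of_contDiff_two hW _).norm).pow 2
    · exact (hWc.mono' ((subset_tsupport _).trans (tsupport_gradSq_subset W))).mul_left
  have IP : Integrable (fun z => g z.1 * ⟪W z, dt W z + lap W z⟫) (volume : Measure (ℝ × E)) :=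
    integrable_of_continuous_hasCompactSupport
      (cg.mul (hW.continuous.inner ((continuous_dt_of_contDiff_two hW).add
        (continuous_lap_of_contDiff_two hW))))
      (hasCompactSupport_mul_inner_left hWc)
  -- integrate (P1) and (P2)
  have int1 : (1 / 2) * (∫ z, g z.1 * (Ξ z ^ 2 * gradSq u z)) - ∫ z, g z.1 * (gradSq Ξ z * ‖u z‖ ^ 2)
      ≤ ∫ z, g z.1 * gradSq W z := by
    have h : ∫ z, ((1 / 2) * (g z.1 * (Ξ z ^ 2 * gradSq u z)) - g z.1 * (gradSq Ξ z * ‖u z‖ ^ 2)) ≤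
        ∫ z, g z.1 * gradSq W z :=
      integral_mono ((Iq.const_mul (1 / 2)).sub IG) IW fun z => by
        show (1 / 2) * (g z.1 * (Ξ z ^ 2 * gradSq u z)) - g z.1 * (gradSq Ξ z * ‖u z‖ ^ 2) ≤
          g z.1 * gradSq W z
        have := P1 z
        linarith
    rwa [integral_sub (Iq.const_mul _) IG, integral_const_mul] at h
  have int2 : -(∫ z, g z.1 * ⟪W z, dt W z + lap W z⟫) ≤
      (1 / 4) * (∫ z, g z.1 * (Ξ z ^ 2 * gradSq u z)) + ∫ z, g z.1 * (A z * ‖u z‖ ^ 2) := by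
    have h : ∫ z, -(g z.1 * ⟪W z, dt W z + lap W z⟫) ≤
        ∫ z, ((1 / 4) * (g z.1 * (Ξ z ^ 2 * gradSq u z)) + g z.1 * (A z * ‖u z‖ ^ 2)) :=
      integral_mono IP.neg ((Iq.const_mul (1 / 4)).add IA) fun z => by
        show -(g z.1 * ⟪W z, dt W z + lap W z⟫) ≤
          (1 / 4) * (g z.1 * (Ξ z ^ 2 * gradSq u z)) + g z.1 * (A z * ‖u z‖ ^ 2)
        have := P2 z
        linarith
    rwa [integral_neg, integral_add (Iq.const_mul _) IA, integral_const_mul] at h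
  -- conclude
  have hfinal : ∫ z, g z.1 * (Ξ z ^ 2 * gradSq u z) ≤
      4 * ((∫ z, g z.1 * (A z * ‖u z‖ ^ 2)) + ∫ z, g z.1 * (gradSq Ξ z * ‖u z‖ ^ 2)) := by
    linarith
  refine hfinal.trans (le_of_eq ?_)
  rw [← integral_add IA IG]
  congr 1
  refine integral_congr_ae (Eventually.of_forall fun z => ?_)
  show g z.1 * (A z * ‖u z‖ ^ 2) + g z.1 * (gradSq Ξ z * ‖u z‖ ^ 2) = _
  simp only [hA]
  ring

end Caccioppoli

end Carleman

end Literature.Analysis.FluidPDE
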